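import Mathlib.Analysis.InnerProductSpace.Basic
import Literature.MathematicalPhysics.QuantumFieldTheory.Balaban1983to89.B4Eq19LatticePoincareMorrey
import HarnessLib

/-!
# Line «poincare_lipschitz» on crux `HistoryTailL` (stmt-QuantumFields-19936), route crux `BlockLipschitzL` (stmt-QuantumFields-23533), K2 organ of record LOC-REG-MIN —
# FLAT SHADOW «ENERGY → RANGE» (E→R) FOR LATTICE MINIMISERS INTO A SPHERE, FILE 2b: THE VECTOR-VALUED `ℓ¹` POINCARÉ INEQUALITY ON A BOX OF `ℤ^d`
# `∃ c, Σ_{x ∈ Q_ρ(z)} ‖u x − c‖ ≤ (2ρ+1)·Σ_{x ∈ Q_ρ(z)} Σ_μ ‖u(x+e_μ) − u x‖` (values in any real normed space), its mean form, and the NEAR-SPHERE BOUND FOR THE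
# BOX MEAN OF A UNIT FIELD `1 − ‖ū‖ ≤ 2(2ρ+1)·(#Q)⁻¹·Σ_Q Σ_μ ‖∂_μ u‖ ≤ 2(2ρ+1)·√(d·(#Q)⁻¹·E(u; Q))`

Cell `ym3-torus` (YM ladder rung R3 = continuum SU(2) Yang–Mills on the three-torus — a RUNG, NOT the Clay problem: not d = 4, not infinite volume, not a mass gap); width seat
`ym-ust-19936-w5` gen 12 (LEAD ym-ust-19936-w1 g8 2026-08-29T04:55:44Z ∕ 05:00:37Z «E→R — GO … F1→F2»; my LOCATE `E2R-ROAD-w5g12.md` (19936∕23533 evidence) §2 step (iii),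
§3 brick F2).  THEOREMS ONLY (def-free), a PORT of lit ✓`B4Eq19LatticePoincareMorrey.exists_poincare_l1` ∕ ✓`abs_sub_lineAvg_sum_le` ∕ ✓`sum_box_lineAvg` from `ℝ` to an
arbitrary real normed space `V` (absolute values ↦ norms, division ↦ `•`), in the `ℤ^d` letters of lit ✓`B4Eq19LatticeOperators` (`Zd`, `box`, `unitVec`; `V = ℝ⁴ ⊃ S³` is
the instance of record); `--supports stmt-QuantumFields-19936`.  Nothing here proves E→R, LOC-REG-MIN, `hReg`, hG, a per-bond chart, a stub, `BlockLipschitzL`, `HistoryTailL`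
or a summit statement; nothing twisted ∕ covariant is in this file.

WHY (`E2R-ROAD-w5g12.md` §2 (iii)): the Schoen–Uhlenbeck competitor `π(ū_{σ(x)}(x))` needs `‖ū_σ(x)‖ ≥ ½` pointwise in the layer; for a UNIT field,
`1 − ‖ū‖ ≤ avg_Q ‖u − ū‖` trivially (`1 = ‖u y‖ ≤ ‖u y − ū‖ + ‖ū‖`), so the `ℓ¹` Poincaré inequality — not the `ℓ²` one, which the tree does not hold for `Zd` boxes —
already gives `1 − ‖ū_σ(x)‖ ≤ 2(2σ+1)·avg_{Q_σ(x)} Σ_μ‖∂_μu‖ ≤ 2√d·√((2σ+1)²·avg Σ_μ‖∂_μu‖²)` = `2√d·√(normalised energy at scale σ)` (`#Q_σ = (2σ+1)^d`): SMALL where the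
multi-scale good shell (F3, px8 g5) makes the normalised energy small.
* §1 `sum_box_lineSum` (`Σ_{x∈Q} Σ_{s∈I_j} v(x[j:=s]) = (2ρ+1) • Σ_{x∈Q} v x`, any `AddCommMonoid`), ★ `norm_sub_line_sum_le` (port of ✓`abs_sub_lineAvg_sum_le`:
  `Σ_{s∈I_j} ‖v x − v(x[j:=s])‖ ≤ (2ρ+1)·Σ_{t∈I_j} ‖v(x[j:=t] + e_j) − v(x[j:=t])‖`);
* §2 ★★ `exists_poincare_l1_vec` (THE VECTOR `ℓ¹` POINCARÉ INEQUALITY, port of ✓`exists_poincare_l1`: induction on the set of averaged coordinates);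
* §3 `norm_mean_sub_le_mean_norm_sub` (`‖ū − c‖ ≤ (#Q)⁻¹Σ‖u − c‖`), ★ `sum_norm_sub_mean_le` (MEAN FORM `Σ_Q‖u − ū‖ ≤ 2(2ρ+1)·Σ_QΣ_μ‖∂_μu‖`),
  `one_sub_norm_mean_le_mean_norm_sub` (`1 − ‖ū‖ ≤ (#Q)⁻¹Σ_Q‖u − ū‖` for unit fields), ★★ `one_sub_norm_boxMean_le` (NEAR-SPHERE OF THE BOX MEAN:
  `1 − ‖ū‖ ≤ 2(2ρ+1)·(#Q)⁻¹·Σ_QΣ_μ‖∂_μu‖`), `sum_sum_norm_le_sqrt` (`Σ_QΣ_μ‖∂u‖ ≤ √(d·#Q·Σ_QΣ_μ‖∂u‖²)`), ★★ `one_sub_norm_boxMean_le_sqrt`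
  (`1 − ‖ū‖ ≤ 2(2ρ+1)·√(d·(#Q)⁻¹·Σ_QΣ_μ‖∂_μu‖²)`).
[folklore] ([Giaquinta1984] Ch. III §1 Thm 1.2 p.70 (Poincaré on cubes); [SchoenUhlenbeck1982] §4 (`dist(u_σ, N)` small from small scaled energy); the lattice statements
are this file's, the proofs are line-by-line ports of the tree's scalar ones).
-/

set_option autoImplicit false

noncomputable section

open scoped BigOperators
open Finset

namespace Summit.QuantumFields.YangMills.Theorems.PoincareLipschitzSphereMapPoincareL1

open Literature.MathematicalPhysics.QuantumFieldTheory.Balaban1983to89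
open B4Eq19LatticeOperators
open B4Eq19LatticePoincareMorrey (update_mem_box)

variable {d : ℕ} {V : Type*} [NormedAddCommGroup V] [NormedSpace ℝ V]

/-! ## §1 One-coordinate averaging -/

/-- **Box sums are invariant under one-coordinate summation**: `Σ_{x ∈ Q} Σ_{s ∈ I_j} v(x[j := s]) = (2ρ+1) • Σ_{x ∈ Q} v(x)` (each point of `Q` is hit `2ρ+1` times),
for values in any additive commutative monoid. [folklore] (port of lit ✓`sum_box_lineAvg`) [cite: Giaquinta1984, Ch. III §1 p.65] -/
theorem sum_box_lineSum {α : Type*} [AddCommMonoid α] (z : Zd d) (ρ : ℤ) (j : Fin d) (v : Zd d → α) :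
    ∑ x ∈ box z ρ, ∑ s ∈ Finset.Icc (z j - ρ) (z j + ρ), v (Function.update x j s) = (2 * ρ + 1).toNat • ∑ x ∈ box z ρ, v x := by
  classical
  have hn : (Finset.Icc (z j - ρ) (z j + ρ)).card = (2 * ρ + 1).toNat := by
    rw [Int.card_Icc, show z j + ρ + 1 - (z j - ρ) = 2 * ρ + 1 by ring]
  rw [sum_box_eq_sum_update (α := α) z ρ j (z j) (fun x => ∑ s ∈ Finset.Icc (z j - ρ) (z j + ρ), v (Function.update x j s)),
    sum_box_eq_sum_update (α := α) z ρ j (z j) v]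
  simp only [Function.update_idem]
  rw [Finset.sum_const, hn]
  congr 1
  exact Finset.sum_comm

omit [NormedSpace ℝ V] in
/-- ★ **The `ℓ¹` deviation from the points of a coordinate line is at most `(2ρ+1)` line variations** (vector-valued): for `x ∈ Q_ρ(z)`,
`Σ_{s ∈ I_j} ‖v(x) − v(x[j:=s])‖ ≤ (2ρ+1)·Σ_{t ∈ I_j} ‖v(x[j:=t] + e_j) − v(x[j:=t])‖`. [folklore] (port of lit ✓`abs_sub_lineAvg_sum_le`)
[cite: Giaquinta1984, Ch. III §1 p.65] -/
theorem norm_sub_line_sum_le (z : Zd d) {ρ : ℤ} (hρ : 0 ≤ ρ) (j : Fin d) (v : Zd d → V) {x : Zd d} (hx : x ∈ box z ρ) :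
    ∑ s ∈ Finset.Icc (z j - ρ) (z j + ρ), ‖v x - v (Function.update x j s)‖ ≤
      ((2 * ρ + 1 : ℤ) : ℝ) * ∑ t ∈ Finset.Icc (z j - ρ) (z j + ρ), ‖v (Function.update x j t + unitVec j) - v (Function.update x j t)‖ := by
  classical
  set I := Finset.Icc (z j - ρ) (z j + ρ) with hI
  set W := ∑ t ∈ I, ‖v (Function.update x j t + unitVec j) - v (Function.update x j t)‖ with hW
  have hupd : ∀ (a : ℤ) (m : ℕ), Function.update x j (a + m) + unitVec j = Function.update x j (a + ((m + 1 : ℕ) : ℤ)) := by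
    intro a m
    funext i
    by_cases hi : i = j
    · subst hi; simp; ring
    · simp [Function.update_of_ne hi, unitVec_apply_ne hi]
  -- telescoping between two points of the line
  have step : ∀ (a : ℤ) (m : ℕ),
      ‖v (Function.update x j a) - v (Function.update x j (a + m))‖ ≤
        ∑ t ∈ Finset.range m, ‖v (Function.update x j (a + t) + unitVec j) - v (Function.update x j (a + t))‖ := by
    intro a m
    induction m with
    | zero => simp
    | succ m ih =>
      rw [Finset.sum_range_succ]
      calc ‖v (Function.update x j a) - v (Function.update x j (a + (m + 1 : ℕ)))‖
          = ‖(v (Function.update x j a) - v (Function.update x j (a + m))) -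
              (v (Function.update x j (a + m) + unitVec j) - v (Function.update x j (a + m)))‖ := by
            rw [hupd]; congr 1; abel
        _ ≤ ‖v (Function.update x j a) - v (Function.update x j (a + m))‖ +
              ‖v (Function.update x j (a + m) + unitVec j) - v (Function.update x j (a + m))‖ := norm_sub_le _ _
        _ ≤ _ := by linarith
  -- a range sum along the line inside `I` is at most `W`
  have range_le : ∀ (a : ℤ) (m : ℕ), a ∈ I → a + m ∈ I →
      ∑ t ∈ Finset.range m, ‖v (Function.update x j (a + t) + unitVec j) - v (Function.update x j (a + t))‖ ≤ W := by
    intro a m ha ham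
    rw [hI, Finset.mem_Icc] at ha ham
    have hinj : ∀ t ∈ Finset.range m, ∀ t' ∈ Finset.range m, (fun t : ℕ => a + t) t = (fun t : ℕ => a + t) t' → t = t' := by
      intro t _ t' _ h; simp only [add_right_inj, Nat.cast_inj] at h; exact h
    rw [← Finset.sum_image (f := fun s => ‖v (Function.update x j s + unitVec j) - v (Function.update x j s)‖) hinj]
    refine Finset.sum_le_sum_of_subset_of_nonneg (fun s hs => ?_) fun _ _ _ => norm_nonneg _
    rw [Finset.mem_image] at hs
    obtain ⟨t, ht, rfl⟩ := hs
    rw [Finset.mem_range] at ht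
    rw [hI, Finset.mem_Icc]; constructor
    · linarith [ha.1]
    · have : (t : ℤ) ≤ m := by exact_mod_cast ht.le
      linarith [ham.2]
  have pair : ∀ s ∈ I, ∀ s' ∈ I, ‖v (Function.update x j s) - v (Function.update x j s')‖ ≤ W := by
    intro s hs s' hs'
    rcases le_total s s' with h | h
    · obtain ⟨m, hm⟩ : ∃ m : ℕ, s' = s + m := ⟨(s' - s).toNat, by rw [Int.toNat_of_nonneg (by linarith)]; ring⟩
      rw [hm] at hs' ⊢
      exact (step s m).trans (range_le s m hs hs')
    · obtain ⟨m, hm⟩ : ∃ m : ℕ, s = s' + m := ⟨(s - s').toNat, by rw [Int.toNat_of_nonneg (by linarith)]; ring⟩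
      rw [hm] at hs ⊢
      rw [norm_sub_rev]
      exact (step s' m).trans (range_le s' m hs' hs)
  have hxj : x j ∈ I := by
    rw [hI, Finset.mem_Icc]; have := (mem_box.1 hx) j; rw [abs_le] at this; constructor <;> linarith [this.1, this.2]
  have hn : ((I.card : ℕ) : ℝ) = ((2 * ρ + 1 : ℤ) : ℝ) := by
    rw [hI, Int.card_Icc, show z j + ρ + 1 - (z j - ρ) = 2 * ρ + 1 by ring]
    have : (0 : ℤ) ≤ 2 * ρ + 1 := by linarith
    rw [← Int.cast_natCast, Int.toNat_of_nonneg this]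
  calc ∑ s ∈ I, ‖v x - v (Function.update x j s)‖ ≤ ∑ s ∈ I, W := Finset.sum_le_sum fun s hs => by
          have := pair (x j) hxj s hs; rwa [Function.update_eq_self] at this
    _ = ((2 * ρ + 1 : ℤ) : ℝ) * W := by rw [Finset.sum_const, nsmul_eq_mul, hn]

/-! ## §2 The vector-valued `ℓ¹` Poincaré inequality on a box -/

/-- ★★ **THE VECTOR-VALUED `ℓ¹` POINCARÉ INEQUALITY ON A BOX OF `ℤ^d`**: for `ρ ≥ 0` and `u : ℤ^d → V` (`V` any real normed space) there is a constant `c ∈ V` with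
`Σ_{x ∈ Q_ρ(z)} ‖u(x) − c‖ ≤ (2ρ+1)·Σ_{x ∈ Q_ρ(z)} Σ_μ ‖u(x + e_μ) − u(x)‖`.  (Induction on the set `T` of averaged coordinates, exactly as in the scalar lit
✓`exists_poincare_l1`: there is `w`, depending only on the coordinates outside `T` on `Q`, with `Σ_Q ‖u − w‖ ≤ (2ρ+1) Σ_{i ∈ T} Σ_Q ‖∂_i u‖` and
`Σ_Q ‖∂_j w‖ ≤ Σ_Q ‖∂_j u‖` for `j ∉ T`.) [folklore] [cite: Giaquinta1984, Ch. III §1 Thm 1.2 p.70] -/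
theorem exists_poincare_l1_vec (u : Zd d → V) (z : Zd d) {ρ : ℤ} (hρ : 0 ≤ ρ) :
    ∃ c : V, ∑ x ∈ box z ρ, ‖u x - c‖ ≤ ((2 * ρ + 1 : ℤ) : ℝ) * ∑ x ∈ box z ρ, ∑ μ, ‖u (x + unitVec μ) - u x‖ := by
  classical
  set Q := box z ρ with hQ
  set n : ℝ := ((2 * ρ + 1 : ℤ) : ℝ) with hn
  have hn0 : 0 < n := by rw [hn]; exact_mod_cast (show (0:ℤ) < 2 * ρ + 1 by linarith)
  have hnat : (((2 * ρ + 1).toNat : ℕ) : ℝ) = n := by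
    rw [hn, ← Int.cast_natCast, Int.toNat_of_nonneg (by linarith)]
  have claim : ∀ T : Finset (Fin d), ∃ w : Zd d → V,
      (∀ x ∈ Q, ∀ y ∈ Q, (∀ i, i ∉ T → x i = y i) → w x = w y) ∧
      (∀ j, j ∉ T → ∑ x ∈ Q, ‖w (x + unitVec j) - w x‖ ≤ ∑ x ∈ Q, ‖u (x + unitVec j) - u x‖) ∧
      (∑ x ∈ Q, ‖u x - w x‖ ≤ n * ∑ i ∈ T, ∑ x ∈ Q, ‖u (x + unitVec i) - u x‖) := by
    intro T
    induction T using Finset.induction_on with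
    | empty =>
      refine ⟨u, fun x _ y _ h => ?_, fun j _ => le_rfl, by simp⟩
      congr 1; funext i; exact h i (by simp)
    | insert j T hj ih =>
      obtain ⟨w, hconst, hgrad, hdev⟩ := ih
      set I := Finset.Icc (z j - ρ) (z j + ρ) with hI
      have hcard : (I.card : ℝ) = n := by
        rw [hI, Int.card_Icc, show z j + ρ + 1 - (z j - ρ) = 2 * ρ + 1 by ring, hn]
        have : (0 : ℤ) ≤ 2 * ρ + 1 := by linarith
        rw [← Int.cast_natCast, Int.toNat_of_nonneg this]
      refine ⟨fun x => n⁻¹ • ∑ s ∈ I, w (Function.update x j s), ?_, ?_, ?_⟩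
      · -- depends only on coordinates outside `insert j T`
        intro x hx y hy hxy
        show n⁻¹ • ∑ s ∈ I, w (Function.update x j s) = n⁻¹ • ∑ s ∈ I, w (Function.update y j s)
        congr 1
        refine Finset.sum_congr rfl fun s hs => hconst _ (update_mem_box hx j hs) _ (update_mem_box hy j hs) fun i hi => ?_
        by_cases hij : i = j
        · subst hij; simp
        · rw [Function.update_of_ne hij, Function.update_of_ne hij]
          exact hxy i (by simp [hij, hi])
      · -- differences in the remaining directions do not increase
        intro j' hj'
        have hj'j : j' ≠ j := fun h => hj' (by simp [h])
        have hj'T : j' ∉ T := fun h => hj' (Finset.mem_insert_of_mem h)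
        have hcomm : ∀ x, n⁻¹ • ∑ s ∈ I, w (Function.update (x + unitVec j') j s) - n⁻¹ • ∑ s ∈ I, w (Function.update x j s) =
            n⁻¹ • ∑ s ∈ I, (w (Function.update x j s + unitVec j') - w (Function.update x j s)) := by
          intro x
          rw [← smul_sub, ← Finset.sum_sub_distrib]
          congr 1
          refine Finset.sum_congr rfl fun s _ => ?_
          have : Function.update (x + unitVec j') j s = Function.update x j s + unitVec j' := by
            funext i
            by_cases hi : i = j
            · subst hi; simp [unitVec_apply_ne (Ne.symm hj'j)]
            · simp [Function.update_of_ne hi]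
          rw [this]
        calc ∑ x ∈ Q, ‖n⁻¹ • ∑ s ∈ I, w (Function.update (x + unitVec j') j s) - n⁻¹ • ∑ s ∈ I, w (Function.update x j s)‖
            = ∑ x ∈ Q, n⁻¹ * ‖∑ s ∈ I, (w (Function.update x j s + unitVec j') - w (Function.update x j s))‖ := by
              refine Finset.sum_congr rfl fun x _ => ?_
              rw [hcomm, norm_smul, Real.norm_eq_abs, abs_of_pos (inv_pos.2 hn0)]
          _ ≤ ∑ x ∈ Q, n⁻¹ * ∑ s ∈ I, ‖w (Function.update x j s + unitVec j') - w (Function.update x j s)‖ :=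
              Finset.sum_le_sum fun x _ => mul_le_mul_of_nonneg_left (norm_sum_le _ _) (inv_pos.2 hn0).le
          _ = n⁻¹ * ∑ x ∈ Q, ∑ s ∈ I, ‖w (Function.update x j s + unitVec j') - w (Function.update x j s)‖ := by rw [Finset.mul_sum]
          _ = ∑ x ∈ Q, ‖w (x + unitVec j') - w x‖ := by
              rw [hQ, hI, sum_box_lineSum z ρ j (fun x => ‖w (x + unitVec j') - w x‖), ← hQ, nsmul_eq_mul, hnat, ← mul_assoc,
                inv_mul_cancel₀ hn0.ne', one_mul]
          _ ≤ ∑ x ∈ Q, ‖u (x + unitVec j') - u x‖ := hgrad j' hj'T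
      · -- deviation: `Σ‖u − A_j w‖ ≤ Σ‖u − w‖ + Σ‖w − A_j w‖`
        have hdev' : ∑ x ∈ Q, ‖w x - n⁻¹ • ∑ s ∈ I, w (Function.update x j s)‖ ≤ n * ∑ x ∈ Q, ‖u (x + unitVec j) - u x‖ := by
          have h1 : ∀ x ∈ Q, ‖w x - n⁻¹ • ∑ s ∈ I, w (Function.update x j s)‖ ≤ n⁻¹ * ∑ s ∈ I, ‖w x - w (Function.update x j s)‖ := by
            intro x _
            have e : w x - n⁻¹ • ∑ s ∈ I, w (Function.update x j s) = n⁻¹ • ∑ s ∈ I, (w x - w (Function.update x j s)) := by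
              rw [Finset.sum_sub_distrib, Finset.sum_const, smul_sub, ← Nat.cast_smul_eq_nsmul ℝ, smul_smul, hcard, inv_mul_cancel₀ hn0.ne',
                one_smul]
            rw [e, norm_smul, Real.norm_eq_abs, abs_of_pos (inv_pos.2 hn0)]
            exact mul_le_mul_of_nonneg_left (norm_sum_le _ _) (inv_pos.2 hn0).le
          have h2 : ∀ x ∈ Q, n⁻¹ * ∑ s ∈ I, ‖w x - w (Function.update x j s)‖ ≤
              ∑ t ∈ I, ‖w (Function.update x j t + unitVec j) - w (Function.update x j t)‖ := by
            intro x hx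
            rw [inv_mul_le_iff₀ hn0]
            exact norm_sub_line_sum_le z hρ j w hx
          calc ∑ x ∈ Q, ‖w x - n⁻¹ • ∑ s ∈ I, w (Function.update x j s)‖
              ≤ ∑ x ∈ Q, ∑ t ∈ I, ‖w (Function.update x j t + unitVec j) - w (Function.update x j t)‖ :=
                Finset.sum_le_sum fun x hx => (h1 x hx).trans (h2 x hx)
            _ = n * ∑ x ∈ Q, ‖w (x + unitVec j) - w x‖ := by
                rw [hQ, hI, sum_box_lineSum z ρ j (fun x => ‖w (x + unitVec j) - w x‖), ← hQ, nsmul_eq_mul, hnat]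
            _ ≤ n * ∑ x ∈ Q, ‖u (x + unitVec j) - u x‖ := mul_le_mul_of_nonneg_left (hgrad j hj) hn0.le
        calc ∑ x ∈ Q, ‖u x - n⁻¹ • ∑ s ∈ I, w (Function.update x j s)‖
            ≤ ∑ x ∈ Q, (‖u x - w x‖ + ‖w x - n⁻¹ • ∑ s ∈ I, w (Function.update x j s)‖) := Finset.sum_le_sum fun x _ => by
              have := norm_add_le (u x - w x) (w x - n⁻¹ • ∑ s ∈ I, w (Function.update x j s))
              rwa [show u x - w x + (w x - n⁻¹ • ∑ s ∈ I, w (Function.update x j s)) =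
                u x - n⁻¹ • ∑ s ∈ I, w (Function.update x j s) by abel] at this
          _ = ∑ x ∈ Q, ‖u x - w x‖ + ∑ x ∈ Q, ‖w x - n⁻¹ • ∑ s ∈ I, w (Function.update x j s)‖ := Finset.sum_add_distrib
          _ ≤ n * ∑ i ∈ T, ∑ x ∈ Q, ‖u (x + unitVec i) - u x‖ + n * ∑ x ∈ Q, ‖u (x + unitVec j) - u x‖ := add_le_add hdev hdev'
          _ = n * ∑ i ∈ insert j T, ∑ x ∈ Q, ‖u (x + unitVec i) - u x‖ := by rw [Finset.sum_insert hj]; ring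
  obtain ⟨w, hconst, _, hdev⟩ := claim Finset.univ
  refine ⟨w z, ?_⟩
  calc ∑ x ∈ Q, ‖u x - w z‖ = ∑ x ∈ Q, ‖u x - w x‖ := Finset.sum_congr rfl fun x hx => by
          rw [hconst x hx z (self_mem_box z hρ) fun i hi => absurd (Finset.mem_univ i) hi]
    _ ≤ n * ∑ i ∈ (Finset.univ : Finset (Fin d)), ∑ x ∈ Q, ‖u (x + unitVec i) - u x‖ := hdev
    _ = n * ∑ x ∈ Q, ∑ μ, ‖u (x + unitVec μ) - u x‖ := by rw [Finset.sum_comm]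

/-! ## §3 Mean form and the near-sphere bound for the box mean of a unit field -/

/-- `‖ū − c‖ ≤ (#Q)⁻¹·Σ_Q ‖u − c‖` for the mean `ū = (#Q)⁻¹•Σ_Q u` over a nonempty finset. [folklore] -/
theorem norm_mean_sub_le_mean_norm_sub {α : Type*} (Q : Finset α) (hQ : Q.Nonempty) (u : α → V) (c : V) :
    ‖((Q.card : ℝ))⁻¹ • ∑ y ∈ Q, u y - c‖ ≤ ((Q.card : ℝ))⁻¹ * ∑ y ∈ Q, ‖u y - c‖ := by
  have hc : (Q.card : ℝ) ≠ 0 := by exact_mod_cast hQ.card_pos.ne'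
  have hc0 : (0 : ℝ) < Q.card := by exact_mod_cast hQ.card_pos
  have e : ((Q.card : ℝ))⁻¹ • ∑ y ∈ Q, u y - c = ((Q.card : ℝ))⁻¹ • ∑ y ∈ Q, (u y - c) := by
    rw [Finset.sum_sub_distrib, Finset.sum_const, smul_sub, ← Nat.cast_smul_eq_nsmul ℝ, smul_smul, inv_mul_cancel₀ hc, one_smul]
  rw [e, norm_smul, Real.norm_eq_abs, abs_of_pos (inv_pos.2 hc0)]
  exact mul_le_mul_of_nonneg_left (norm_sum_le _ _) (inv_pos.2 hc0).le

/-- ★ **MEAN FORM OF THE `ℓ¹` POINCARÉ INEQUALITY**: `Σ_{Q_ρ(z)} ‖u − ū‖ ≤ 2(2ρ+1)·Σ_{Q_ρ(z)} Σ_μ ‖u(x+e_μ) − u(x)‖` for the box mean `ū = (#Q)⁻¹•Σ_Q u`.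
[folklore] [cite: Giaquinta1984, Ch. III §1 Thm 1.2 p.70] -/
theorem sum_norm_sub_mean_le (u : Zd d → V) (z : Zd d) {ρ : ℤ} (hρ : 0 ≤ ρ) :
    ∑ x ∈ box z ρ, ‖u x - (((box z ρ).card : ℝ))⁻¹ • ∑ y ∈ box z ρ, u y‖ ≤
      2 * ((2 * ρ + 1 : ℤ) : ℝ) * ∑ x ∈ box z ρ, ∑ μ, ‖u (x + unitVec μ) - u x‖ := by
  obtain ⟨c, hc⟩ := exists_poincare_l1_vec u z hρ
  have hne : (box z ρ).Nonempty := ⟨z, self_mem_box z hρ⟩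
  have hQ0 : (0 : ℝ) < (box z ρ).card := by exact_mod_cast hne.card_pos
  set m : V := (((box z ρ).card : ℝ))⁻¹ • ∑ y ∈ box z ρ, u y with hm
  have hmc : ‖m - c‖ ≤ (((box z ρ).card : ℝ))⁻¹ * ∑ y ∈ box z ρ, ‖u y - c‖ := norm_mean_sub_le_mean_norm_sub _ hne u c
  have h1 : ∀ x ∈ box z ρ, ‖u x - m‖ ≤ ‖u x - c‖ + ‖m - c‖ := fun x _ => by
    have := norm_sub_le (u x - c) (m - c)
    rwa [show u x - c - (m - c) = u x - m by abel] at this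
  calc ∑ x ∈ box z ρ, ‖u x - m‖ ≤ ∑ x ∈ box z ρ, (‖u x - c‖ + ‖m - c‖) := Finset.sum_le_sum h1
    _ = ∑ x ∈ box z ρ, ‖u x - c‖ + (box z ρ).card * ‖m - c‖ := by rw [Finset.sum_add_distrib, Finset.sum_const, nsmul_eq_mul]
    _ ≤ ∑ x ∈ box z ρ, ‖u x - c‖ + (box z ρ).card * ((((box z ρ).card : ℝ))⁻¹ * ∑ y ∈ box z ρ, ‖u y - c‖) := by
        linarith [mul_le_mul_of_nonneg_left hmc hQ0.le]
    _ = 2 * ∑ x ∈ box z ρ, ‖u x - c‖ := by rw [← mul_assoc, mul_inv_cancel₀ hQ0.ne', one_mul]; ring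
    _ ≤ 2 * (((2 * ρ + 1 : ℤ) : ℝ) * ∑ x ∈ box z ρ, ∑ μ, ‖u (x + unitVec μ) - u x‖) := by linarith
    _ = _ := by ring

/-- For a UNIT field, `1 − ‖ū‖ ≤ (#Q)⁻¹·Σ_Q ‖u − ū‖` (`1 = ‖u y‖ ≤ ‖u y − ū‖ + ‖ū‖` at every site). [folklore] [cite: SchoenUhlenbeck1982, §4] -/
theorem one_sub_norm_mean_le_mean_norm_sub {α : Type*} (Q : Finset α) (hQ : Q.Nonempty) (u : α → V) (hu : ∀ y ∈ Q, ‖u y‖ = 1) :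
    1 - ‖((Q.card : ℝ))⁻¹ • ∑ y ∈ Q, u y‖ ≤ ((Q.card : ℝ))⁻¹ * ∑ y ∈ Q, ‖u y - ((Q.card : ℝ))⁻¹ • ∑ y' ∈ Q, u y'‖ := by
  set m : V := ((Q.card : ℝ))⁻¹ • ∑ y' ∈ Q, u y' with hm
  have hc0 : (0 : ℝ) < Q.card := by exact_mod_cast hQ.card_pos
  have h1 : ∀ y ∈ Q, 1 - ‖m‖ ≤ ‖u y - m‖ := fun y hy => by
    have := norm_le_norm_add_norm_sub' (u y) m
    rw [hu y hy] at this
    have h2 : ‖u y - m‖ = ‖u y - m‖ := rfl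
    linarith [norm_sub_rev (u y) m, this]
  have h2 : (Q.card : ℝ) * (1 - ‖m‖) ≤ ∑ y ∈ Q, ‖u y - m‖ := by
    have := Finset.sum_le_sum h1
    rwa [Finset.sum_const, nsmul_eq_mul] at this
  rw [le_inv_mul_iff₀ hc0]; exact h2

/-- ★★ **NEAR-SPHERE OF THE BOX MEAN OF A UNIT FIELD**: `ρ ≥ 0`, `‖u‖ = 1` on `Q_ρ(z)` ⟹
`1 − ‖ū‖ ≤ 2(2ρ+1)·(#Q_ρ)⁻¹·Σ_{x∈Q_ρ(z)} Σ_μ ‖u(x+e_μ) − u(x)‖` for `ū = (#Q_ρ)⁻¹•Σ_{Q_ρ(z)} u`. [folklore] [cite: SchoenUhlenbeck1982, §4] -/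
theorem one_sub_norm_boxMean_le (u : Zd d → V) (z : Zd d) {ρ : ℤ} (hρ : 0 ≤ ρ) (hu : ∀ y ∈ box z ρ, ‖u y‖ = 1) :
    1 - ‖(((box z ρ).card : ℝ))⁻¹ • ∑ y ∈ box z ρ, u y‖ ≤
      2 * ((2 * ρ + 1 : ℤ) : ℝ) * ((((box z ρ).card : ℝ))⁻¹ * ∑ x ∈ box z ρ, ∑ μ, ‖u (x + unitVec μ) - u x‖) := by
  have hne : (box z ρ).Nonempty := ⟨z, self_mem_box z hρ⟩
  have hQ0 : (0 : ℝ) < (box z ρ).card := by exact_mod_cast hne.card_pos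
  have h1 := one_sub_norm_mean_le_mean_norm_sub (box z ρ) hne u hu
  have h2 := sum_norm_sub_mean_le u z hρ
  have h3 := mul_le_mul_of_nonneg_left h2 (inv_pos.2 hQ0).le
  calc 1 - ‖(((box z ρ).card : ℝ))⁻¹ • ∑ y ∈ box z ρ, u y‖ ≤ _ := h1
    _ ≤ _ := h3
    _ = _ := by ring

omit [NormedSpace ℝ V] in
/-- `ℓ¹ ≤ √(#·ℓ²)` for a double sum of norms: `Σ_{x∈Q} Σ_μ ‖g x μ‖ ≤ √(d · #Q · Σ_{x∈Q} Σ_μ ‖g x μ‖²)`. [folklore] (vector twin of lit ✓`sum_abs_fdiff_le_sqrt`)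
[cite: Giaquinta1984, Ch. III §1 p.65] -/
theorem sum_sum_norm_le_sqrt (Q : Finset (Zd d)) (g : Zd d → Fin d → V) :
    ∑ x ∈ Q, ∑ μ, ‖g x μ‖ ≤ Real.sqrt (d * Q.card * ∑ x ∈ Q, ∑ μ, ‖g x μ‖ ^ 2) := by
  rw [← Finset.sum_product', ← Finset.sum_product' (f := fun x μ => ‖g x μ‖ ^ 2)]
  have hcs := Finset.sum_mul_sq_le_sq_mul_sq (Q ×ˢ (Finset.univ : Finset (Fin d))) (fun p => ‖g p.1 p.2‖) (fun _ => (1 : ℝ))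
  simp only [mul_one, one_pow, Finset.sum_const, nsmul_eq_mul, Finset.card_product, Finset.card_univ, Fintype.card_fin] at hcs
  have h0 : 0 ≤ ∑ p ∈ Q ×ˢ (Finset.univ : Finset (Fin d)), ‖g p.1 p.2‖ := Finset.sum_nonneg fun _ _ => norm_nonneg _
  rw [← Real.sqrt_sq h0]
  refine Real.sqrt_le_sqrt ?_
  calc (∑ p ∈ Q ×ˢ (Finset.univ : Finset (Fin d)), ‖g p.1 p.2‖) ^ 2 ≤ (∑ p ∈ Q ×ˢ (Finset.univ : Finset (Fin d)), ‖g p.1 p.2‖ ^ 2) * ((Q.card * d : ℕ) : ℝ) := hcs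
    _ = d * Q.card * ∑ p ∈ Q ×ˢ (Finset.univ : Finset (Fin d)), ‖g p.1 p.2‖ ^ 2 := by push_cast; ring

/-- ★★ **NEAR-SPHERE OF THE BOX MEAN, ENERGY FORM**: `ρ ≥ 0`, `‖u‖ = 1` on `Q_ρ(z)` ⟹
`1 − ‖ū‖ ≤ 2(2ρ+1)·√(d · (#Q_ρ)⁻¹ · Σ_{x∈Q_ρ(z)} Σ_μ ‖u(x+e_μ) − u(x)‖²)` — with `#Q_ρ = (2ρ+1)^d` this is `2√d·√((2ρ+1)^{2−d}·E(u; Q_ρ(z)))`, twice the root of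
`d` times the NORMALISED energy at scale `ρ`: the Schoen–Uhlenbeck «`dist(u_σ, N)` is small where the scaled energy is small», on `ℤ^d`, from the `ℓ¹` Poincaré inequality alone.
[folklore] [cite: SchoenUhlenbeck1982, §4] -/
theorem one_sub_norm_boxMean_le_sqrt (u : Zd d → V) (z : Zd d) {ρ : ℤ} (hρ : 0 ≤ ρ) (hu : ∀ y ∈ box z ρ, ‖u y‖ = 1) :
    1 - ‖(((box z ρ).card : ℝ))⁻¹ • ∑ y ∈ box z ρ, u y‖ ≤
      2 * ((2 * ρ + 1 : ℤ) : ℝ) * Real.sqrt (d * (((box z ρ).card : ℝ))⁻¹ * ∑ x ∈ box z ρ, ∑ μ, ‖u (x + unitVec μ) - u x‖ ^ 2) := by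
  have hne : (box z ρ).Nonempty := ⟨z, self_mem_box z hρ⟩
  have hQ0 : (0 : ℝ) < (box z ρ).card := by exact_mod_cast hne.card_pos
  have hn0 : (0 : ℝ) ≤ ((2 * ρ + 1 : ℤ) : ℝ) := by exact_mod_cast (show (0:ℤ) ≤ 2 * ρ + 1 by linarith)
  have h1 := one_sub_norm_boxMean_le u z hρ hu
  have h2 := sum_sum_norm_le_sqrt (box z ρ) (fun x μ => u (x + unitVec μ) - u x)
  -- `(#Q)⁻¹ · √(d · #Q · S) = √(d · (#Q)⁻¹ · S)`
  set S : ℝ := ∑ x ∈ box z ρ, ∑ μ, ‖u (x + unitVec μ) - u x‖ ^ 2 with hS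
  set cQ : ℝ := ((box z ρ).card : ℝ) with hcQ
  have e : (d : ℝ) * cQ⁻¹ * S = (cQ⁻¹) ^ 2 * (d * cQ * S) := by
    field_simp
  have h3 : Real.sqrt (d * cQ⁻¹ * S) = cQ⁻¹ * Real.sqrt (d * cQ * S) := by
    rw [e, Real.sqrt_mul (sq_nonneg _), Real.sqrt_sq (inv_pos.2 hQ0).le]
  have h4 : cQ⁻¹ * ∑ x ∈ box z ρ, ∑ μ, ‖u (x + unitVec μ) - u x‖ ≤ Real.sqrt (d * cQ⁻¹ * S) := by
    rw [h3]; exact mul_le_mul_of_nonneg_left h2 (inv_pos.2 hQ0).le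
  calc _ ≤ _ := h1
    _ ≤ _ := mul_le_mul_of_nonneg_left h4 (by positivity)

end Summit.QuantumFields.YangMills.Theorems.PoincareLipschitzSphereMapPoincareL1
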